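import Mathlib
import HarnessLib
import Literature.Computability.AlgebraicComplexity.PatternExpressions
import Summits.ValiantsHypothesis.ValiantsHypothesis.Theorems.MonotoneRestorationOrbitRestorationQPHomSpanTools
import Summits.ValiantsHypothesis.ValiantsHypothesis.Theorems.MonotoneRestorationOrbitRestorationLinearVolumeQPHomPolyBasics

/-!
# Matrix-symmetric polynomials are linear combinations of homomorphism polynomials

Route MonotoneRestoration; crux `OrbitRestorationQP` (stmt-18293, K1 / K1ᵉ) and derived node
`NonnegRestorationQP` (stmt-16191, `stub_orbitCompression` = `OrbitCompressionQP`, cut through narrow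
pattern expressions).  THE SPANNING HALF of "homomorphism polynomials of bipartite patterns form a basis of
the matrix-symmetric polynomials" (Dwivedi–Pago–Seppelt 2026 §8; the independence half, Lemma 8.18, is
`HomExpansionUnique.homPoly_linearIndependent`):

**Theorem** (`mem_span_homPoly_of_matrixSymmetric`).  Every polynomial `p` on the `n × n` matrix that is
invariant under independent row and column permutations lies in the `ℂ`-span of the homomorphism
polynomials `hom_{F,n}` of bipartite multigraph patterns `F = (Fin a ⊔ Fin b, E)` with
`a, b ≤ deg p` (and `|E| ≤ deg p`).

Proof (by the number of rows and columns a monomial uses, no Möbius function needed).  By the Reynolds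
identity `|G|·p = Σ_D coeff_D · orbitSum D` (`HomSpan.card_smul_eq_sum_orbitSum`) it suffices to expand
orbit sums of monomial exponents `D`.  Present `D` as the injective placement of its own pattern `F_D`
(rows and columns used by `D` as vertices, the cells of `D` with multiplicity as edges — no isolated
vertices; `exists_presentation`).  The Reynolds identity for `hom_{F_D,n}`
(`HomSpan.card_smul_homPoly_eq_sum_orbitSum`) reads `|G|·hom_{F_D,n} = Σ_h orbitSum D_h` over all vertex
maps `h`; the injective `h` all contribute `orbitSum D` (`orbitSum_push_eq_of_injective`), and a
non-injective `h` pushes `D` to an exponent using FEWER rows or columns and the same number of cells —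
handled by induction.  Solving for `orbitSum D` (the number of injective placements is a nonzero natural
number) finishes.

* `exists_presentation` — the pattern of a monomial exponent;
* `orbitSum_mem_span_homPoly` — orbit sums are combinations of homomorphism polynomials (the induction);
* `mem_span_homPoly_of_matrixSymmetric` — the theorem.

Consequences for the lines (sequel files): the polylog-degree FLOOR of K1ᵉ / of the repaired
`stub_orbitToNarrowExpression` (matrix-symmetric polylog-degree families ARE closed narrow pattern
expressions, VP-free), via `OrbitRestorationQPHomPolyClose.exists_close_eq_homPoly`.
[cite: DwivediPagoSeppelt2026, §8 (Lemma 8.18)]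
-/

noncomputable section

open MvPolynomial

-- `Summit.ValiantsHypothesis.ValiantsHypothesis.…` is the tree's single-conjunct layout (Sub = Summit).
set_option linter.dupNamespace false

namespace Summit.ValiantsHypothesis.ValiantsHypothesis.Theorems

namespace HomSpan

open Literature.Computability.AlgebraicComplexity

variable {n : ℕ}

/-! ### The pattern of a monomial exponent -/

/-- **The pattern of a monomial exponent.**  Every exponent `D` on the `n × n` matrix is the injective
push-forward of a bipartite pattern without isolated vertices whose numbers of row and column vertices are
the numbers of rows and columns used by `D` and whose number of edges is the degree of `D`. [folklore] -/
theorem exists_presentation (D : (Fin n × Fin n) →₀ ℕ) :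
    ∃ (A B : Type) (_ : Fintype A) (_ : DecidableEq A) (_ : Fintype B) (_ : DecidableEq B)
      (E : Multiset (A × B)) (h₀ : (A → Fin n) × (B → Fin n)),
      (∀ a, ∃ e ∈ E, e.1 = a) ∧ (∀ b, ∃ e ∈ E, e.2 = b) ∧
      Function.Injective h₀.1 ∧ Function.Injective h₀.2 ∧
      Multiset.toFinsupp (E.map fun e => (h₀.1 e.1, h₀.2 e.2)) = D ∧
      Fintype.card A = (D.support.image Prod.fst).card ∧
      Fintype.card B = (D.support.image Prod.snd).card ∧
      Multiset.card E = Multiset.card (Finsupp.toMultiset D) := by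
  classical
  have hfst : ∀ x : {ij // ij ∈ Finsupp.toMultiset D}, x.1.1 ∈ D.support.image Prod.fst := fun x =>
    Finset.mem_image_of_mem _ (Finsupp.mem_toMultiset _ _ |>.1 x.2)
  have hsnd : ∀ x : {ij // ij ∈ Finsupp.toMultiset D}, x.1.2 ∈ D.support.image Prod.snd := fun x =>
    Finset.mem_image_of_mem _ (Finsupp.mem_toMultiset _ _ |>.1 x.2)
  let E : Multiset ((D.support.image Prod.fst) × (D.support.image Prod.snd)) :=
    (Finsupp.toMultiset D).attach.map fun x => (⟨x.1.1, hfst x⟩, ⟨x.1.2, hsnd x⟩)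
  refine ⟨(D.support.image Prod.fst), (D.support.image Prod.snd), inferInstance, inferInstance,
    inferInstance, inferInstance, E, (Subtype.val, Subtype.val), ?_, ?_, Subtype.val_injective,
    Subtype.val_injective, ?_, Fintype.card_coe _, Fintype.card_coe _, by simp [E]⟩
  · rintro ⟨i, hi⟩
    obtain ⟨ij, hij, rfl⟩ := Finset.mem_image.1 hi
    exact ⟨(⟨ij.1, hfst ⟨ij, (Finsupp.mem_toMultiset _ _).2 hij⟩⟩, ⟨ij.2, hsnd ⟨ij, (Finsupp.mem_toMultiset _ _).2 hij⟩⟩),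
      Multiset.mem_map.2 ⟨⟨ij, (Finsupp.mem_toMultiset _ _).2 hij⟩, Multiset.mem_attach _ _, rfl⟩, rfl⟩
  · rintro ⟨j, hj⟩
    obtain ⟨ij, hij, rfl⟩ := Finset.mem_image.1 hj
    exact ⟨(⟨ij.1, hfst ⟨ij, (Finsupp.mem_toMultiset _ _).2 hij⟩⟩, ⟨ij.2, hsnd ⟨ij, (Finsupp.mem_toMultiset _ _).2 hij⟩⟩),
      Multiset.mem_map.2 ⟨⟨ij, (Finsupp.mem_toMultiset _ _).2 hij⟩, Multiset.mem_attach _ _, rfl⟩, rfl⟩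
  · have : E.map (fun e => ((e.1 : Fin n), (e.2 : Fin n))) = Finsupp.toMultiset D := by
      simp only [E, Multiset.map_map, Function.comp_def, Prod.mk.eta, Multiset.attach_map_val]
    rw [this, Finsupp.toMultiset_toFinsupp]

/-! ### Bookkeeping -/

/-- The number of rows used is at most the degree. [folklore] -/
theorem card_image_fst_le_card (D : (Fin n × Fin n) →₀ ℕ) :
    (D.support.image Prod.fst).card ≤ Multiset.card (Finsupp.toMultiset D) := by
  refine Finset.card_image_le.trans ?_
  rw [Finsupp.card_toMultiset, Finsupp.sum, Finset.card_eq_sum_ones]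
  exact Finset.sum_le_sum fun ij hij => Nat.one_le_iff_ne_zero.2 (Finsupp.mem_support_iff.1 hij)

/-- The number of columns used is at most the degree. [folklore] -/
theorem card_image_snd_le_card (D : (Fin n × Fin n) →₀ ℕ) :
    (D.support.image Prod.snd).card ≤ Multiset.card (Finsupp.toMultiset D) := by
  refine Finset.card_image_le.trans ?_
  rw [Finsupp.card_toMultiset, Finsupp.sum, Finset.card_eq_sum_ones]
  exact Finset.sum_le_sum fun ij hij => Nat.one_le_iff_ne_zero.2 (Finsupp.mem_support_iff.1 hij)

/-- Transport: the homomorphism polynomial of a pattern on arbitrary finite vertex types is one of a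
pattern on `Fin a × Fin b` with the same numbers of vertices and edges. [folklore] -/
theorem homPoly_mem_homSet {A B : Type} [Fintype A] [DecidableEq A] [Fintype B] [DecidableEq B]
    (E : Multiset (A × B)) (n d : ℕ) (hA : Fintype.card A ≤ d) (hB : Fintype.card B ≤ d)
    (hE : Multiset.card E ≤ d) :
    homPoly E n ℂ ∈ {q : MvPolynomial (Fin n × Fin n) ℂ | ∃ (a b : ℕ) (E' : Multiset (Fin a × Fin b)),
      a ≤ d ∧ b ≤ d ∧ Multiset.card E' ≤ d ∧ q = homPoly E' n ℂ} := by
  refine ⟨Fintype.card A, Fintype.card B,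
    E.map fun e => (Fintype.equivFin A e.1, Fintype.equivFin B e.2), hA, hB, by simpa using hE, ?_⟩
  rw [HomPolyBasics.homPoly_map_equiv]

/-! ### Orbit sums are combinations of homomorphism polynomials -/

/-- **Orbit sums of monomial exponents lie in the span of homomorphism polynomials** of patterns with at
most `d` row vertices, `d` column vertices and `d` edges, `d ≥` the degree (strong induction on the number
of rows and columns used). [cite: DwivediPagoSeppelt2026, §8] -/
theorem orbitSum_mem_span_homPoly (d : ℕ) :
    ∀ (ν : ℕ) (D : (Fin n × Fin n) →₀ ℕ),
      (D.support.image Prod.fst).card + (D.support.image Prod.snd).card = ν →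
      Multiset.card (Finsupp.toMultiset D) ≤ d →
      (∑ g : Equiv.Perm (Fin n) × Equiv.Perm (Fin n),
          monomial (D.mapDomain fun ij : Fin n × Fin n => (g.1 ij.1, g.2 ij.2)) (1 : ℂ)) ∈
        Submodule.span ℂ {q : MvPolynomial (Fin n × Fin n) ℂ | ∃ (a b : ℕ) (E : Multiset (Fin a × Fin b)),
          a ≤ d ∧ b ≤ d ∧ Multiset.card E ≤ d ∧ q = homPoly E n ℂ} := by
  classical
  intro ν
  induction ν using Nat.strong_induction_on with
  | _ ν ih =>
  intro D hν hd
  obtain ⟨A, B, iA, dA, iB, dB, E, h₀, hEA, hEB, h₁, h₂, hD, hcA, hcB, hcE⟩ := exists_presentation D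
  -- the set of injective placements
  set I : Finset ((A → Fin n) × (B → Fin n)) :=
    Finset.univ.filter fun h => Function.Injective h.1 ∧ Function.Injective h.2 with hI
  have h₀I : h₀ ∈ I := Finset.mem_filter.2 ⟨Finset.mem_univ _, h₁, h₂⟩
  -- Reynolds identity for `hom_{F_D}` split along `I`
  have hR := card_smul_homPoly_eq_sum_orbitSum E n
  rw [← Finset.sum_filter_add_sum_filter_not Finset.univ
    (fun h : (A → Fin n) × (B → Fin n) => Function.Injective h.1 ∧ Function.Injective h.2)] at hR
  -- injective placements all give `orbitSum D`
  have hinj : ∑ h ∈ I, ∑ g : Equiv.Perm (Fin n) × Equiv.Perm (Fin n),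
      monomial ((Multiset.toFinsupp (E.map fun e => (h.1 e.1, h.2 e.2))).mapDomain
        fun ij : Fin n × Fin n => (g.1 ij.1, g.2 ij.2)) (1 : ℂ) =
      (I.card : ℂ) • ∑ g : Equiv.Perm (Fin n) × Equiv.Perm (Fin n),
        monomial (D.mapDomain fun ij : Fin n × Fin n => (g.1 ij.1, g.2 ij.2)) (1 : ℂ) := by
    rw [Finset.sum_congr rfl fun h hh => ?_, Finset.sum_const, ← Nat.cast_smul_eq_nsmul ℂ]
    obtain ⟨-, hh1, hh2⟩ := Finset.mem_filter.1 hh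
    rw [orbitSum_push_eq_of_injective E h₀ h h₁ h₂ hh1 hh2, hD]
  -- non-injective placements use fewer rows or columns
  have hnon : ∀ h ∈ Finset.univ.filter (fun h : (A → Fin n) × (B → Fin n) =>
      ¬ (Function.Injective h.1 ∧ Function.Injective h.2)),
      (∑ g : Equiv.Perm (Fin n) × Equiv.Perm (Fin n),
        monomial ((Multiset.toFinsupp (E.map fun e => (h.1 e.1, h.2 e.2))).mapDomain
          fun ij : Fin n × Fin n => (g.1 ij.1, g.2 ij.2)) (1 : ℂ)) ∈
        Submodule.span ℂ {q : MvPolynomial (Fin n × Fin n) ℂ | ∃ (a b : ℕ) (E : Multiset (Fin a × Fin b)),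
          a ≤ d ∧ b ≤ d ∧ Multiset.card E ≤ d ∧ q = homPoly E n ℂ} := by
    intro h hh
    obtain ⟨-, hh⟩ := Finset.mem_filter.1 hh
    refine ih _ ?_ _ rfl (by rw [card_toMultiset_push, hcE]; exact hd)
    rw [← hν, support_push_image_fst E hEA, support_push_image_snd E hEB, ← hcA, ← hcB]
    have le1 : (Finset.univ.image h.1).card ≤ Fintype.card A := Finset.card_image_le.trans (by simp)
    have le2 : (Finset.univ.image h.2).card ≤ Fintype.card B := Finset.card_image_le.trans (by simp)
    rcases not_and_or.1 hh with hn1 | hn2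
    · have lt1 : (Finset.univ.image h.1).card < Fintype.card A := by
        refine lt_of_le_of_ne le1 fun heq => hn1 ?_
        have := Finset.injOn_of_card_image_eq (s := Finset.univ) (f := h.1)
          (by rw [Finset.card_univ]; exact heq)
        simpa [Set.injOn_univ] using this
      omega
    · have lt2 : (Finset.univ.image h.2).card < Fintype.card B := by
        refine lt_of_le_of_ne le2 fun heq => hn2 ?_
        have := Finset.injOn_of_card_image_eq (s := Finset.univ) (f := h.2)
          (by rw [Finset.card_univ]; exact heq)
        simpa [Set.injOn_univ] using this
      omega
  -- the pattern's own homomorphism polynomial is a generator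
  have hhom : homPoly E n ℂ ∈ Submodule.span ℂ {q : MvPolynomial (Fin n × Fin n) ℂ |
      ∃ (a b : ℕ) (E : Multiset (Fin a × Fin b)), a ≤ d ∧ b ≤ d ∧ Multiset.card E ≤ d ∧ q = homPoly E n ℂ} := by
    refine Submodule.subset_span (homPoly_mem_homSet E n d ?_ ?_ (hcE ▸ hd))
    · rw [hcA]; exact (card_image_fst_le_card D).trans hd
    · rw [hcB]; exact (card_image_snd_le_card D).trans hd
  -- solve for `orbitSum D`
  have hIne : (I.card : ℂ) ≠ 0 := Nat.cast_ne_zero.2 (Finset.card_ne_zero.2 ⟨h₀, h₀I⟩)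
  rw [hinj] at hR
  have hsolve : (∑ g : Equiv.Perm (Fin n) × Equiv.Perm (Fin n),
      monomial (D.mapDomain fun ij : Fin n × Fin n => (g.1 ij.1, g.2 ij.2)) (1 : ℂ)) =
      (I.card : ℂ)⁻¹ • ((Fintype.card (Equiv.Perm (Fin n) × Equiv.Perm (Fin n)) : ℂ) • homPoly E n ℂ -
        ∑ h ∈ Finset.univ.filter (fun h : (A → Fin n) × (B → Fin n) =>
            ¬ (Function.Injective h.1 ∧ Function.Injective h.2)),
          ∑ g : Equiv.Perm (Fin n) × Equiv.Perm (Fin n),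
            monomial ((Multiset.toFinsupp (E.map fun e => (h.1 e.1, h.2 e.2))).mapDomain
              fun ij : Fin n × Fin n => (g.1 ij.1, g.2 ij.2)) (1 : ℂ)) := by
    rw [hR, add_sub_cancel_right, smul_smul, inv_mul_cancel₀ hIne, one_smul]
  rw [hsolve]
  exact Submodule.smul_mem _ _ (Submodule.sub_mem _ (Submodule.smul_mem _ _ hhom)
    (Submodule.sum_mem _ hnon))

/-! ### The theorem -/

/-- **Matrix-symmetric polynomials are linear combinations of homomorphism polynomials.**  Every
polynomial on the `n × n` matrix invariant under independent row and column permutations lies in the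
`ℂ`-span of the homomorphism polynomials of bipartite patterns on `Fin a ⊔ Fin b` with `a, b ≤ deg p`
and at most `deg p` edges. [cite: DwivediPagoSeppelt2026, §8] -/
theorem mem_span_homPoly_of_matrixSymmetric (p : MvPolynomial (Fin n × Fin n) ℂ)
    (hp : ∀ σ τ : Equiv.Perm (Fin n),
      rename (fun ij : Fin n × Fin n => (σ ij.1, τ ij.2)) p = p) :
    p ∈ Submodule.span ℂ {q : MvPolynomial (Fin n × Fin n) ℂ | ∃ (a b : ℕ) (E : Multiset (Fin a × Fin b)),
      a ≤ p.totalDegree ∧ b ≤ p.totalDegree ∧ Multiset.card E ≤ p.totalDegree ∧ q = homPoly E n ℂ} := by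
  classical
  have hG : (Fintype.card (Equiv.Perm (Fin n) × Equiv.Perm (Fin n)) : ℂ) ≠ 0 :=
    Nat.cast_ne_zero.2 Fintype.card_ne_zero
  have key := card_smul_eq_sum_orbitSum p hp
  have hmem : (Fintype.card (Equiv.Perm (Fin n) × Equiv.Perm (Fin n)) : ℂ) • p ∈
      Submodule.span ℂ {q : MvPolynomial (Fin n × Fin n) ℂ | ∃ (a b : ℕ) (E : Multiset (Fin a × Fin b)),
        a ≤ p.totalDegree ∧ b ≤ p.totalDegree ∧ Multiset.card E ≤ p.totalDegree ∧ q = homPoly E n ℂ} := by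
    rw [key]
    refine Submodule.sum_mem _ fun D hD => Submodule.smul_mem _ _
      (orbitSum_mem_span_homPoly p.totalDegree _ D rfl ?_)
    rw [Finsupp.card_toMultiset]
    exact le_totalDegree hD
  have := Submodule.smul_mem _ ((Fintype.card (Equiv.Perm (Fin n) × Equiv.Perm (Fin n)) : ℂ)⁻¹) hmem
  rwa [smul_smul, inv_mul_cancel₀ hG, one_smul] at this

end HomSpan

end Summit.ValiantsHypothesis.ValiantsHypothesis.Theorems

end
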